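import Literature.Barriers.QuantumAdvantage.AaronsonChenOracle
import Literature.Barriers.QuantumAdvantage.AaronsonChenSimulation
import Literature.Computability.Cryptography.OracleAdversaryPrecomp
import Literature.Computability.Cryptography.StatisticalDistanceProofs
import Literature.Computability.QuantumComplexity.OracleCircuitLocality
import Literature.Computability.Complexity.PolyTimeCountable
import Literature.Computability.Complexity.CookReducibilityTransitive
import Mathlib.MeasureTheory.OuterMeasure.BorelCantelli
import Mathlib.Analysis.SpecificLimits.Basic
import Mathlib.Analysis.Complex.Exponential
import Mathlib.Data.Set.Finite.List
import HarnessLib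

/-!
# Aaronson–Chen 2017, Thm. 5.1 (first half): `SampBQP^{TQBF,O} ⊆ SampBPP^{TQBF,O}` with probability `1`, from Lemma 5.3

Sibling proof file (D-0014 append protocol) of `AaronsonChenOracle.lean`, whose named fact
`aaronsonChen2017_thm51_sampBQP_subset` vendors the printed conclusion of §5.3 of

* S. Aaronson, L. Chen, *Complexity-theoretic foundations of quantum supremacy experiments*,
  CCC 2017 (arXiv:1612.05903) [AaronsonChen2017], proof of the first part of **Thm. 5.1**
  (p. 21): "So `SampBQP^{TQBF,O} ⊆ SampBPP^{TQBF,O}` with probability `1`."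

**The printed proof** (p. 21). Fix a `SampBQP` oracle algorithm `M` and let `A` be the `SampBPP`
algorithm of **Lemma 5.3** (`aaronsonChen2017_lem53`: on `⟨x, 0^{1/ε}⟩` the output laws of
`M^{TQBF,O}` and `A^{TQBF,O}` are `ε`-close with probability `≥ 1 − exp(−(2|x| + 1/ε))` over
`O ∼ 𝒟_O`). Call `(x, k)` a bad pair if the laws at accuracy `k` are not close; "the expected
number of bad pairs is upper-bounded by `∑ₙ 2ⁿ ∑ₖ exp(−(2n + ·)) = O(1)`. This means that with
probability 1, there are only finitely many bad pairs, so we can handle them by hardwiring their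
results into the algorithm `A` to get the algorithm `A_M`"; "since there are only countably many
`SampBQP` oracle algorithms `M`, we see with probability `1`, for every `M`, there is a classical
algorithm `A_M`"; finally `A'` on `⟨x, 0^{1/ε}⟩` runs `A_M` at accuracy `ε/2` and the triangle
inequality gives `‖𝒟^{A'}_{x,ε} − S_x‖ ≤ ε`.

**What is proved here.** The main theorem
`aaronsonChen2017_thm51_sampBQP_subset_of_lem53 : aaronsonChen2017_lem53 → aaronsonChen2017_thm51_sampBQP_subset`
formalizes exactly this argument in the tree's models (Q2 uniform Clifford+T families with
XOR-query gates, C4a PPT oracle adversaries, `𝒟_O = acOracleMeasure`), reducing the fact to the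
single leaf `aaronsonChen2017_lem53` (whence also `aaronsonChen2017_thm51_samp` and Cor. 5.2 from
Lemma 5.3, the trivial inclusion and the `PH` half: `aaronsonChen2017_thm51_samp_of_lem53`,
`aaronsonChen2017_cor52_of_lem53`). The ingredients, all proved:

* *measurability of the good events* `goodEvent F post 𝒜 x k` (the output laws on `⟨x, 1^k⟩`
  are `1/k`-close): they are determined by finitely many oracle bits — the quantum kernel reads
  only strings shorter than the circuit width (`QCircuit.toMatrix_congr` of
  `BQPCollapsingOracle.lean`; `kernel_congr_of_length_lt`), and a transcript adversary run
  against a LANGUAGE oracle (one-bit answers) can only ever ask the finitely many queries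
  `OracleAlg.potQueries` reachable along Boolean answer lists (`OracleAlg.run_ofLanguage_congr`,
  `OracleAdversary.outputPMF_ofLanguage_congr`) — hence `IsDetermined`, hence measurable
  (`RandomOracleCylinders.lean`), so that Lemma 5.3's lower bound on the good event bounds the
  measure of the bad event (`measure_badEvent_le`);
* *Borel–Cantelli* (Mathlib's `MeasureTheory.ae_finite_setOf_mem`) with the summability
  `∑_{(x,k)} exp(−(2|x| + k)) = (∑ₙ (2e⁻²)ⁿ)(∑ₖ e^{−k}) < ∞` (`tsum_badBound_ne_top`; in the tree's
  accuracy convention `ε = 1/k` the paper's substitution `ε = 2^{−k}` is not needed);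
* *countability* of the `SampBQP` oracle algorithms `(F, post)`: uniform families and
  polynomial-time maps are computed by countably many machines
  (`countable_setOf_polyTimeComputable`, `Complexity/PolyTimeCountable.lean`;
  `countable_sampBQPAlgorithms`), and `MeasureTheory.ae_ball_iff`;
* *hard-wiring and rescaling*: finitely many bad pairs have a largest accuracy parameter, so some
  `K₀` makes EVERY pair `(x, k)` with `k ≥ K₀` good; the algorithm `A'` running `A` on
  `⟨x, 1^{2k + K₀}⟩` (`shiftAccuracy`, polynomial-time by the tree's string bricks; the PPT
  closure under preprocessing `OracleAdversary.exists_ppt_outputPMF_precomp` of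
  `Cryptography/OracleAdversaryPrecomp.lean`) is within `2/(2k + K₀) ≤ 1/k` of `S_x` by the
  triangle inequality (`PMF.tvDist_triangle_holds`). This realises the paper's "hardwiring" and
  its `ε/2` step in one preprocessing (the hard-wired table of the finitely many bad pairs is
  replaced by never running at a bad accuracy), with the same conclusion.

## What remains for `aaronsonChen2017_thm51_sampBQP_subset_holds`

Exactly `aaronsonChen2017_lem53_holds` (Lemma 5.3, "the most technical part of the whole
section": the gate-replacement hybrid argument, the posterior analysis of `𝒟_O` with the Chernoff
bound, and a `PSPACE` simulation of the replaced circuit by a polynomial-time TM2 oracle machine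
querying `TQBF` — a theory in the tree's machine models). Revision 2 (2026-08-15): the tree's
`AaronsonChenSimulation.lean` decomposes `aaronsonChen2017_lem53` into the named facts
`aaronsonChen2017_lem53_machine` (the `SampBPP^{TQBF,O}` machine) and
`aaronsonChen2017_lem53_losses` (the probabilistic analysis), its deterministic quantum half being
proved there; `aaronsonChen2017_thm51_sampBQP_subset_of_lem53_leaves` records the target's
resulting leaf list (those two facts), and `aaronsonChen2017_cor52_of_lem53_leaves` that of
Cor. 5.2 (plus `SampPRel_subset_SampBQPRel` and `aaronsonChen2017_thm51_ph`).

## Sources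

* [AaronsonChen2017] arXiv:1612.05903, read via `lit read arxiv:1612.05903 --pages 20-24`: §5.2
  (`𝒟_O`), Thm. 5.1, Lemma 5.3 and the proof of the first part of Thm. 5.1 (p. 21), proof of
  Lemma 5.3 (pp. 21–23).
* [AroraBarakCC2009] §3.4 (oracle machines: runs are determined by the answers), §1.4 (machines
  as strings), as used by the imported tree files.
-/

noncomputable section

open MeasureTheory _root_.Computability Literature.Computability.Complexity
  Literature.Computability.Cryptography Literature.Computability.QuantumComplexity
open scoped ENNReal

namespace Literature.Barriers.QuantumAdvantage

/-! ### Locality of transcript algorithms run against a language oracle -/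

section Locality

variable {β : Type}

/-- The queries that `M` can possibly ask on input `x` within `k` rounds against SOME language
oracle: the queries produced by the step function after a list of fewer than `k` one-bit answers
(`encodeBool b`, the answers of `Oracle.ofLanguage`). [cite: AroraBarakCC2009, §3.4] -/
def _root_.Literature.Computability.Complexity.OracleAlg.potQueries (M : OracleAlg β) (x : List Bool)
    (k : ℕ) : Set (List Bool) :=
  {q | ∃ bs : List Bool, bs.length < k ∧ M.step x (bs.map encodeBool) = Sum.inl q}

/-- The potential queries form a finite set (an image of the Boolean lists of length `< k`). [folklore] -/
theorem _root_.Literature.Computability.Complexity.OracleAlg.potQueries_finite (M : OracleAlg β)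
    (x : List Bool) (k : ℕ) : (M.potQueries x k).Finite := by
  have h : M.potQueries x k ⊆
      Sum.inl ⁻¹' ((fun bs : List Bool => M.step x (bs.map encodeBool)) '' {bs | bs.length < k}) := by
    rintro q ⟨bs, hbs, hq⟩
    exact ⟨bs, hbs, hq⟩
  exact (((List.finite_length_lt Bool k).image _).preimage Sum.inl_injective.injOn).subset h

/-- Against language oracles agreeing on the potential queries, the runs of `M` from a Boolean
answer list coincide (auxiliary, fuel-indexed form). [cite: AroraBarakCC2009, §3.4] -/
theorem _root_.Literature.Computability.Complexity.OracleAlg.runAux_ofLanguage_congr (M : OracleAlg β)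
    (x : List Bool) (k : ℕ) {B B' : Language Bool}
    (h : ∀ q ∈ M.potQueries x k, (q ∈ B ↔ q ∈ B')) (j : ℕ) :
    ∀ bs : List Bool, bs.length + j ≤ k →
      M.runAux (Oracle.ofLanguage B) x j (bs.map encodeBool) =
        M.runAux (Oracle.ofLanguage B') x j (bs.map encodeBool) := by
  induction j with
  | zero => intro bs _; rfl
  | succ j ih =>
    intro bs hj
    rw [OracleAlg.runAux_succ, OracleAlg.runAux_succ]
    cases hs : M.step x (bs.map encodeBool) with
    | inr b => rfl
    | inl q =>
      have hq : q ∈ M.potQueries x k := ⟨bs, by omega, hs⟩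
      have hans : Oracle.ofLanguage B q = Oracle.ofLanguage B' q := by
        rw [Oracle.ofLanguage_apply, Oracle.ofLanguage_apply, boolIndicator_congr (h q hq)]
      have happ : bs.map encodeBool ++ [Oracle.ofLanguage B' q] =
          (bs ++ [B'.boolIndicator q]).map encodeBool := by
        simp
      show M.runAux (Oracle.ofLanguage B) x j (bs.map encodeBool ++ [Oracle.ofLanguage B q]) =
        M.runAux (Oracle.ofLanguage B') x j (bs.map encodeBool ++ [Oracle.ofLanguage B' q])
      rw [hans, happ]
      exact ih (bs ++ [B'.boolIndicator q]) (by simp; omega)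

/-- **Locality of transcript algorithms against language oracles**: the run of `M` on `x` within
`k` rounds is the same for two language oracles agreeing on the finitely many potential queries.
[cite: AroraBarakCC2009, §3.4] -/
theorem _root_.Literature.Computability.Complexity.OracleAlg.run_ofLanguage_congr (M : OracleAlg β)
    {x : List Bool} {k : ℕ} {B B' : Language Bool}
    (h : ∀ q ∈ M.potQueries x k, (q ∈ B ↔ q ∈ B')) :
    M.run (Oracle.ofLanguage B) k x = M.run (Oracle.ofLanguage B') k x :=
  OracleAlg.runAux_ofLanguage_congr M x k h k [] (by simp)

/-- The potential queries of an oracle adversary on input `x`: those of its algorithm on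
`⟨x, r⟩` within `fuel(|x|)` rounds, over all coin strings `r ∈ {0,1}^{coins(|x|)}`. [cite: AroraBarakCC2009, §3.4 with Def. 7.1] -/
def _root_.Literature.Computability.Cryptography.OracleAdversary.potQueries {β : Type}
    (𝒜 : OracleAdversary β) (x : List Bool) : Set (List Bool) :=
  ⋃ r : List.Vector Bool (𝒜.coins.eval x.length),
    𝒜.alg.potQueries (boolPair x r.toList) (𝒜.fuel.eval x.length)

/-- The potential queries of an adversary on a fixed input form a finite set. [folklore] -/
theorem _root_.Literature.Computability.Cryptography.OracleAdversary.potQueries_finite {β : Type}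
    (𝒜 : OracleAdversary β) (x : List Bool) :
    (𝒜.potQueries x).Finite :=
  Set.finite_iUnion fun _ => 𝒜.alg.potQueries_finite _ _

/-- **The output law of an oracle adversary against a language oracle depends only on the
oracle's bits at the finitely many potential queries.** [cite: AroraBarakCC2009, §3.4 with Def. 7.1] -/
theorem _root_.Literature.Computability.Cryptography.OracleAdversary.outputPMF_ofLanguage_congr
    {β : Type} (𝒜 : OracleAdversary β) (x : List Bool)
    {B B' : Language Bool} (h : ∀ q ∈ 𝒜.potQueries x, (q ∈ B ↔ q ∈ B')) :
    𝒜.outputPMF (Oracle.ofLanguage B) x = 𝒜.outputPMF (Oracle.ofLanguage B') x := by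
  rw [OracleAdversary.outputPMF_eq_map, OracleAdversary.outputPMF_eq_map]
  congr 1
  funext r
  exact 𝒜.alg.run_ofLanguage_congr fun q hq => h q (Set.mem_iUnion.2 ⟨r, hq⟩)

/-- **The output kernel of a circuit family depends only on the oracle's strings shorter than the
circuit width** `|x| + ancillas |x|` (`QCircuit.toMatrix_congr`). [cite: BernsteinVazirani1997SICOMP, §8.3 (oracle QTMs)] -/
theorem _root_.Literature.Computability.Cryptography.QCircuitFamily.kernel_congr_of_length_lt
    {G : QGateSet} (F : QCircuitFamily G) (x : List Bool)
    {A B : Language Bool}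
    (h : ∀ w : List Bool, w.length < x.length + F.ancillas x.length → (w ∈ A ↔ w ∈ B)) :
    F.kernel A x = F.kernel B x := by
  simp only [QCircuitFamily.kernel, QCircuit.outputPMF, QCircuit.runOn, QCircuit.toMatrix_congr h]

end Locality

/-! ### The joined oracle on finitely many queries -/

/-- If `O`, `O'` agree on the strings `w` with `1w ∈ Q` then `TQBF ⊕ O`, `TQBF ⊕ O'` agree on `Q`
(queries `0w` go to `TQBF`, the empty query to "no"). [cite: AaronsonChen2017, §5 (p. 20, O₀ ⊕ O₁)] -/
theorem oracleJoin_congr {O O' : Set (List Bool)} {Q : Set (List Bool)}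
    (h : ∀ w : List Bool, true :: w ∈ Q → (w ∈ O ↔ w ∈ O')) :
    ∀ q ∈ Q, (q ∈ oracleJoin TQBF O ↔ q ∈ oracleJoin TQBF O') := by
  intro q hq
  cases q with
  | nil => simp
  | cons b w =>
    cases b with
    | false => simp
    | true =>
      rw [true_cons_mem_oracleJoin, true_cons_mem_oracleJoin]
      exact h w hq

/-! ### The good events and their measurability -/

namespace AaronsonChenThm51

section GoodEvent

variable (F : QCircuitFamily cliffordT) (post : List Bool → List Bool) (𝒜 : OracleAdversary (List Bool))

/-- The output law of the `SampBQP` oracle algorithm `(F, post)` on `⟨x, 1^k⟩` with the oracle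
`TQBF ⊕ O` (the paper's `𝒟^M_{x,ε}`). [cite: AaronsonChen2017, Lemma 5.3 (p. 21)] -/
def lawM (O : Set (List Bool)) (x : List Bool) (k : ℕ) : PMF (List Bool) :=
  (F.kernel (oracleJoin TQBF O) (boolPair x (unaryEncodeNat k))).map post

/-- The output law of the `SampBPP` oracle algorithm `𝒜` on `⟨x, 1^k⟩` with the oracle `TQBF ⊕ O`
(the paper's `𝒟^A_{x,ε}`; no output read as `[]`, as in `SampPRel`). [cite: AaronsonChen2017, Lemma 5.3 (p. 21)] -/
def lawA (O : Set (List Bool)) (x : List Bool) (k : ℕ) : PMF (List Bool) :=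
  PMF.map (fun o => o.getD [])
    (𝒜.outputPMF (Oracle.ofLanguage (oracleJoin TQBF O)) (boolPair x (unaryEncodeNat k)))

/-- The good event of the pair `(x, k)`: the two output laws on `⟨x, 1^k⟩` are within total
variation `1/k` ("`(x, k)` is a bad pair if `‖𝒟^M − 𝒟^A‖ > 2^{-k}`", complemented).
[cite: AaronsonChen2017, proof of Thm. 5.1, first part (p. 21)] -/
def goodEvent (x : List Bool) (k : ℕ) : Set (Set (List Bool)) :=
  {O | (lawM F post O x k).tvDist (lawA 𝒜 O x k) ≤ 1 / (k : ℝ)}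

/-- The oracle strings read on input `⟨x, 1^k⟩`: those `w` with `1w` shorter than the circuit
width, or `1w` a potential query of `𝒜`. [folklore] -/
def relevantStrings (x : List Bool) (k : ℕ) : Set (List Bool) :=
  {w | (true :: w).length <
      (boolPair x (unaryEncodeNat k)).length + F.ancillas (boolPair x (unaryEncodeNat k)).length} ∪
    {w | true :: w ∈ 𝒜.potQueries (boolPair x (unaryEncodeNat k))}

/-- Finitely many oracle strings are read on each input. [folklore] -/
theorem relevantStrings_finite (x : List Bool) (k : ℕ) : (relevantStrings F 𝒜 x k).Finite := by
  refine Set.Finite.union ?_ ?_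
  · refine (List.finite_length_lt Bool
      ((boolPair x (unaryEncodeNat k)).length + F.ancillas (boolPair x (unaryEncodeNat k)).length)).subset ?_
    intro w hw
    simp only [Set.mem_setOf_eq, List.length_cons] at hw ⊢
    omega
  · exact (𝒜.potQueries_finite _).preimage (List.cons_injective.injOn)

/-- Oracles agreeing on the relevant strings have the same `SampBQP` law on `⟨x, 1^k⟩`. [folklore] -/
theorem lawM_congr {O O' : Set (List Bool)} {x : List Bool} {k : ℕ}
    (h : ∀ w ∈ relevantStrings F 𝒜 x k, (w ∈ O ↔ w ∈ O')) : lawM F post O x k = lawM F post O' x k := by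
  unfold lawM
  rw [QCircuitFamily.kernel_congr_of_length_lt F (boolPair x (unaryEncodeNat k))
    (A := oracleJoin TQBF O) (B := oracleJoin TQBF O')]
  exact oracleJoin_congr (Q := {q | q.length < _}) fun w hw => h w (Or.inl hw)

/-- Oracles agreeing on the relevant strings have the same `SampBPP` law on `⟨x, 1^k⟩`. [folklore] -/
theorem lawA_congr {O O' : Set (List Bool)} {x : List Bool} {k : ℕ}
    (h : ∀ w ∈ relevantStrings F 𝒜 x k, (w ∈ O ↔ w ∈ O')) : lawA 𝒜 O x k = lawA 𝒜 O' x k := by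
  unfold lawA
  rw [𝒜.outputPMF_ofLanguage_congr (boolPair x (unaryEncodeNat k))
    (B := oracleJoin TQBF O) (B' := oracleJoin TQBF O')]
  exact oracleJoin_congr fun w hw => h w (Or.inr hw)

/-- **The good events are determined by finitely many oracle bits**, hence measurable for `𝒟_O`.
[folklore] -/
theorem measurableSet_goodEvent (x : List Bool) (k : ℕ) : MeasurableSet (goodEvent F post 𝒜 x k) := by
  refine IsDetermined.measurableSet (U := (relevantStrings_finite F 𝒜 x k).toFinset) fun O O' hOO' => ?_
  have hagree : ∀ w ∈ relevantStrings F 𝒜 x k, (w ∈ O ↔ w ∈ O') := fun w hw => by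
    have := congrFun hOO' ⟨w, (relevantStrings_finite F 𝒜 x k).mem_toFinset.2 hw⟩
    rw [restrictBool_apply, restrictBool_apply] at this
    exact (@decide_eq_decide _ _ (Classical.propDecidable _) (Classical.propDecidable _)).1 this
  simp only [goodEvent, Set.mem_setOf_eq, lawM_congr F post 𝒜 hagree, lawA_congr F 𝒜 hagree]

/-- **The bad events are exponentially rare** (Lemma 5.3, complemented): for `k ≥ 1`,
`𝒟_O (goodEvent x k)ᶜ ≤ exp(−(2|x| + k))`. [cite: AaronsonChen2017, Lemma 5.3 (p. 21)] -/
theorem measure_compl_goodEvent_le {x : List Bool} {k : ℕ}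
    (hgood : 1 - Real.exp (-(2 * (x.length : ℝ) + k)) ≤ acOracleMeasure.real (goodEvent F post 𝒜 x k)) :
    acOracleMeasure (goodEvent F post 𝒜 x k)ᶜ ≤ ENNReal.ofReal (Real.exp (-(2 * (x.length : ℝ) + k))) := by
  set e : ℝ := Real.exp (-(2 * (x.length : ℝ) + k)) with he
  have he0 : 0 ≤ 1 - e := by
    have h0 : (0 : ℝ) ≤ 2 * (x.length : ℝ) + k := by positivity
    have : e ≤ 1 := Real.exp_le_one_iff.2 (by linarith)
    linarith
  have hμ : ENNReal.ofReal (1 - e) ≤ acOracleMeasure (goodEvent F post 𝒜 x k) := by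
    rw [← ENNReal.ofReal_toReal (measure_ne_top acOracleMeasure (goodEvent F post 𝒜 x k))]
    exact ENNReal.ofReal_le_ofReal hgood
  rw [prob_compl_eq_one_sub (measurableSet_goodEvent F post 𝒜 x k)]
  calc 1 - acOracleMeasure (goodEvent F post 𝒜 x k)
      ≤ 1 - ENNReal.ofReal (1 - e) := tsub_le_tsub_left hμ 1
    _ = ENNReal.ofReal e := by
        rw [← ENNReal.ofReal_one, ← ENNReal.ofReal_sub 1 he0]
        congr 1
        ring

/-- The bad event of a pair `(x, k)`: the complement of the good event for `k ≥ 1`, nothing for the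
(unused) accuracy parameter `k = 0`. [cite: AaronsonChen2017, proof of Thm. 5.1, first part (p. 21)] -/
def badEvent (p : List Bool × ℕ) : Set (Set (List Bool)) :=
  if 0 < p.2 then (goodEvent F post 𝒜 p.1 p.2)ᶜ else ∅

/-- The summable bound `exp(−2)^{|x|} · exp(−1)^k` on the measure of the bad events. [folklore] -/
def badBound (p : List Bool × ℕ) : ℝ≥0∞ :=
  ENNReal.ofReal (Real.exp (-2)) ^ p.1.length * ENNReal.ofReal (Real.exp (-1)) ^ p.2

/-- `exp(−(2n + k)) = exp(−2)ⁿ · exp(−1)ᵏ` in `ℝ≥0∞`. [folklore] -/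
theorem ofReal_exp_neg_eq_badBound (x : List Bool) (k : ℕ) :
    ENNReal.ofReal (Real.exp (-(2 * (x.length : ℝ) + k))) = badBound (x, k) := by
  unfold badBound
  rw [← ENNReal.ofReal_pow (Real.exp_pos _).le, ← ENNReal.ofReal_pow (Real.exp_pos _).le,
    ← ENNReal.ofReal_mul (pow_nonneg (Real.exp_pos _).le _), ← Real.exp_nat_mul, ← Real.exp_nat_mul,
    ← Real.exp_add]
  congr 1
  ring

/-- Under Lemma 5.3's guarantee for `𝒜`, every bad event has measure at most its bound.
[cite: AaronsonChen2017, Lemma 5.3 (p. 21)] -/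
theorem measure_badEvent_le
    (hgood : ∀ (x : List Bool) (k : ℕ), 0 < k →
      1 - Real.exp (-(2 * (x.length : ℝ) + k)) ≤ acOracleMeasure.real (goodEvent F post 𝒜 x k))
    (p : List Bool × ℕ) : acOracleMeasure (badEvent F post 𝒜 p) ≤ badBound p := by
  obtain ⟨x, k⟩ := p
  unfold badEvent
  split_ifs with hk
  · rw [← ofReal_exp_neg_eq_badBound]
    exact measure_compl_goodEvent_le F post 𝒜 (hgood x k hk)
  · simp

end GoodEvent

/-! ### Summability: `∑ₓ ∑ₖ exp(−(2|x| + k)) < ∞` -/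

/-- Summing a function of the length over all bit strings: `∑ₓ a^{|x|} = ∑ₙ (2a)ⁿ`. [folklore] -/
theorem tsum_pow_length (a : ℝ≥0∞) : ∑' x : List Bool, a ^ x.length = ∑' n : ℕ, (2 * a) ^ n := by
  let e : (Σ n, List.Vector Bool n) ≃ List Bool := Equiv.sigmaFiberEquiv List.length
  rw [← e.tsum_eq (fun x : List Bool => a ^ x.length), ENNReal.tsum_sigma']
  refine tsum_congr fun n => ?_
  have hterm : ∀ v : List.Vector Bool n, a ^ (e ⟨n, v⟩).length = a ^ n := fun v => by
    rw [show e ⟨n, v⟩ = v.1 from rfl, v.2]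
  simp only [hterm]
  rw [tsum_fintype, Finset.sum_const, Finset.card_univ, card_vector, Fintype.card_bool, nsmul_eq_mul,
    mul_pow]
  push_cast
  rfl

/-- **The bounds on the bad events are summable**: `∑_{(x,k)} exp(−2)^{|x|} exp(−1)^k < ∞`.
[cite: AaronsonChen2017, proof of Thm. 5.1, first part (p. 21, "≤ O(1)")] -/
theorem tsum_badBound_ne_top : ∑' p : List Bool × ℕ, badBound p ≠ ∞ := by
  have hsplit : ∑' p : List Bool × ℕ, badBound p =
      (∑' x : List Bool, ENNReal.ofReal (Real.exp (-2)) ^ x.length) *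
        ∑' k : ℕ, ENNReal.ofReal (Real.exp (-1)) ^ k := by
    unfold badBound
    rw [ENNReal.tsum_prod', ← ENNReal.tsum_mul_right]
    refine tsum_congr fun x => ?_
    dsimp only
    exact ENNReal.tsum_mul_left
  -- `2 · e⁻² < 1` since `e² > 3`
  have h2e : 2 * Real.exp (-2) < 1 := by
    have h3 : (2 : ℝ) + 1 < Real.exp 2 := Real.add_one_lt_exp (by norm_num)
    rw [Real.exp_neg, mul_inv_lt_iff₀ (Real.exp_pos 2)]
    linarith
  rw [hsplit, tsum_pow_length, ENNReal.tsum_geometric, ENNReal.tsum_geometric]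
  refine ENNReal.mul_ne_top (ENNReal.inv_ne_top.2 ?_) (ENNReal.inv_ne_top.2 ?_)
  · refine (tsub_pos_iff_lt.2 ?_).ne'
    rw [← ENNReal.ofReal_ofNat, ← ENNReal.ofReal_mul (by norm_num)]
    exact ENNReal.ofReal_lt_one.2 h2e
  · refine (tsub_pos_iff_lt.2 ?_).ne'
    exact ENNReal.ofReal_lt_one.2 (Real.exp_lt_one_iff.2 (by norm_num))

/-! ### Borel–Cantelli: almost surely, all pairs beyond some accuracy are good -/

/-- **"With probability 1, there are only finitely many bad pairs"** — and hence some `K₀` past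
which every pair `(x, k)`, `k ≥ K₀`, is good (uniformly in `x`). Borel–Cantelli
(`MeasureTheory.ae_finite_setOf_mem`) over the countable index set `{0,1}* × ℕ`.
[cite: AaronsonChen2017, proof of Thm. 5.1, first part (p. 21)] -/
theorem ae_exists_forall_goodEvent (F : QCircuitFamily cliffordT) (post : List Bool → List Bool)
    (𝒜 : OracleAdversary (List Bool))
    (hgood : ∀ (x : List Bool) (k : ℕ), 0 < k →
      1 - Real.exp (-(2 * (x.length : ℝ) + k)) ≤ acOracleMeasure.real (goodEvent F post 𝒜 x k)) :
    ∀ᵐ (O : Set (List Bool)) ∂acOracleMeasure,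
      ∃ K₀ : ℕ, 0 < K₀ ∧ ∀ (x : List Bool) (k : ℕ), K₀ ≤ k → O ∈ goodEvent F post 𝒜 x k := by
  have hsum : ∑' p : List Bool × ℕ, acOracleMeasure (badEvent F post 𝒜 p) ≠ ∞ :=
    ne_top_of_le_ne_top tsum_badBound_ne_top
      (ENNReal.tsum_le_tsum (measure_badEvent_le F post 𝒜 hgood))
  filter_upwards [ae_finite_setOf_mem hsum] with O hO
  obtain ⟨K, hK⟩ := (hO.image Prod.snd).bddAbove
  refine ⟨K + 1, Nat.succ_pos K, fun x k hk => ?_⟩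
  by_contra hbad
  have hmem : (x, k) ∈ {p : List Bool × ℕ | O ∈ badEvent F post 𝒜 p} := by
    show O ∈ badEvent F post 𝒜 (x, k)
    simp only [badEvent, show 0 < k by omega, if_true]
    exact hbad
  have := hK (Set.mem_image_of_mem Prod.snd hmem)
  simp only at this
  omega

/-! ### Countably many `SampBQP` oracle algorithms -/

/-- The description function `1ⁿ ↦ ⟨n, ancillas n, circ n⟩` of a circuit family determines the
family. [folklore] -/
theorem sigmaFn_injective {G : QGateSet} :
    Function.Injective fun F : QCircuitFamily G =>
      fun n => (⟨n, F.ancillas n, F.circ n⟩ : Σ n m : ℕ, QCircuit G (n + m)) := by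
  rintro ⟨a, c⟩ ⟨a', c'⟩ h
  have key : ∀ n, (⟨a n, c n⟩ : Σ m : ℕ, QCircuit G (n + m)) = ⟨a' n, c' n⟩ := fun n =>
    eq_of_heq (Sigma.mk.inj (congrFun h n)).2
  have h1 : a = a' := funext fun n => congrArg Sigma.fst (key n)
  subst h1
  have h2 : c = c' := funext fun n => eq_of_heq (Sigma.mk.inj (key n)).2
  subst h2
  rfl

/-- The `SampBQP` oracle algorithms of the tree's `SampBQPRel`: pairs of a uniform Clifford+T
family with oracle gates and a polynomial-time post-processing. [cite: AaronsonChen2017, Def. 2.3 and §2.2] -/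
def sampBQPAlgorithms : Set (QCircuitFamily cliffordT × (List Bool → List Bool)) :=
  {M | M.1.IsUniform ∧ PolyTimeComputable (id : List Bool → List Bool) (id : List Bool → List Bool) M.2}

/-- **"There are only countably many `SampBQP` oracle algorithms"**: uniform families and
polynomial-time maps are computed by countably many machines
(`countable_setOf_polyTimeComputable`). [cite: AaronsonChen2017, proof of Thm. 5.1, first part (p. 21)] [cite: AroraBarakCC2009, §1.4] -/
theorem countable_sampBQPAlgorithms : sampBQPAlgorithms.Countable := by
  have hF : Set.Countable {F : QCircuitFamily cliffordT | F.IsUniform} := by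
    refine Set.MapsTo.countable_of_injOn
      (f := fun F : QCircuitFamily cliffordT =>
        fun n => (⟨n, F.ancillas n, F.circ n⟩ : Σ n m : ℕ, QCircuit cliffordT (n + m)))
      (t := {f | PolyTimeComputable unaryEncodeNat (QCircuit.sigmaEncode (G := cliffordT)) f})
      (fun F hF => hF) (sigmaFn_injective.injOn) ?_
    exact countable_setOf_polyTimeComputable unaryEncodeNat QCircuit.sigmaEncode_injective
  have hpost : Set.Countable {post : List Bool → List Bool |
      PolyTimeComputable (id : List Bool → List Bool) (id : List Bool → List Bool) post} :=
    countable_setOf_polyTimeComputable id Function.injective_id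
  refine Set.Countable.mono ?_ (hF.prod hpost)
  rintro ⟨F, post⟩ ⟨h1, h2⟩
  exact Set.mk_mem_prod h1 h2

/-! ### Rescaling the accuracy parameter -/

/-- `1^a 1^b = 1^{a+b}` for Mathlib's unary encoding. [folklore] -/
theorem unaryEncodeNat_append (a b : ℕ) :
    unaryEncodeNat a ++ unaryEncodeNat b = unaryEncodeNat (a + b) := by
  have h : ∀ n, unaryEncodeNat n = List.replicate n true := by
    intro n
    induction n with
    | zero => rfl
    | succ n ih => simp [unaryEncodeNat, ih, List.replicate_succ]
  rw [h, h, h, ← List.replicate_add]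

/-- The re-encoding `⟨x, 1^k⟩ ↦ ⟨x, 1^{2k + K₀}⟩` of the accuracy parameter ("run `A_M` on input
`⟨x, 0^{2^k}⟩` with `2^{-k} ≤ ε/2`", here also pushed past the last bad accuracy `K₀`).
[cite: AaronsonChen2017, proof of Thm. 5.1, first part (p. 21)] -/
def shiftAccuracy (K₀ : ℕ) (w : List Bool) : List Bool :=
  boolPair (Brick.fstF w) (Brick.sndF w ++ (Brick.sndF w ++ unaryEncodeNat K₀))

/-- `shiftAccuracy K₀ ⟨x, 1^k⟩ = ⟨x, 1^{2k + K₀}⟩`. [folklore] -/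
@[simp] theorem shiftAccuracy_boolPair (K₀ : ℕ) (x : List Bool) (k : ℕ) :
    shiftAccuracy K₀ (boolPair x (unaryEncodeNat k)) = boolPair x (unaryEncodeNat (2 * k + K₀)) := by
  simp only [shiftAccuracy, Brick.fstF_boolPair, Brick.sndF_boolPair, unaryEncodeNat_append]
  congr 2
  ring

/-- `shiftAccuracy` in the tree's string-brick algebra. [folklore] -/
theorem shiftAccuracy_eq_bricks (K₀ : ℕ) :
    shiftAccuracy K₀ = fanoutFn Brick.fstF (OracleCompose.concatFn ∘ fanoutFn Brick.sndF
      (OracleCompose.concatFn ∘ fanoutFn Brick.sndF fun _ => unaryEncodeNat K₀)) := by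
  funext z
  simp [shiftAccuracy]

/-- **The re-encoding is polynomial-time** (closure of `FP` under fan-out, composition,
concatenation and constants: tree bricks). [folklore] -/
theorem shiftAccuracy_mem_FP (K₀ : ℕ) : shiftAccuracy K₀ ∈ FP := by
  rw [shiftAccuracy_eq_bricks]
  exact fanoutFn_mem_FP Brick.fstF_mem_FP
    (comp_mem_FP OracleCompose.concatFn_mem_FP (fanoutFn_mem_FP Brick.sndF_mem_FP
      (comp_mem_FP OracleCompose.concatFn_mem_FP (fanoutFn_mem_FP Brick.sndF_mem_FP (const_mem_FP _)))))

end AaronsonChenThm51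

/-! ### The first half of Theorem 5.1 from Lemma 5.3 -/

open AaronsonChenThm51

/-- **Aaronson–Chen 2017, Thm. 5.1 (first part), the inclusion of §5.3 from Lemma 5.3**: for
`O ∼ 𝒟_O`, with probability `1`, `SampBQP^{TQBF,O} ⊆ SampBPP^{TQBF,O}`. Proof as printed (p. 21):
for each of the countably many `SampBQP` oracle algorithms `M = (F, post)`
(`countable_sampBQPAlgorithms`, `ae_ball_iff`), Lemma 5.3 gives `𝒜` whose bad pairs are almost
surely finitely many (Borel–Cantelli, `ae_exists_forall_goodEvent`), hence absent beyond some
accuracy `K₀`; a problem `S` solved by `M` is then solved classically by running `𝒜` on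
`⟨x, 1^{2k + K₀}⟩` (`shiftAccuracy`, PPT by `OracleAdversary.exists_ppt_outputPMF_precomp`):
`‖𝒟^{A'} − S_x‖ ≤ 1/(2k + K₀) + 1/(2k + K₀) ≤ 1/k` (`PMF.tvDist_triangle_holds`).
[cite: AaronsonChen2017, Thm. 5.1 and its proof from Lemma 5.3 (p. 21)] -/
theorem aaronsonChen2017_thm51_sampBQP_subset_of_lem53 (h53 : aaronsonChen2017_lem53) :
    aaronsonChen2017_thm51_sampBQP_subset := by
  -- Step 1 (one algorithm): Lemma 5.3 and Borel–Cantelli.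
  have hone : ∀ M ∈ sampBQPAlgorithms, ∀ᵐ (O : Set (List Bool)) ∂acOracleMeasure,
      ∃ 𝒜 : OracleAdversary (List Bool), 𝒜.IsPPT (encodingList Bool) ∧
        ∃ K₀ : ℕ, 0 < K₀ ∧ ∀ (x : List Bool) (k : ℕ), K₀ ≤ k → O ∈ goodEvent M.1 M.2 𝒜 x k := by
    rintro ⟨F, post⟩ ⟨hU, hpost⟩
    obtain ⟨𝒜, h𝒜, hgood⟩ := h53 F post hU hpost
    filter_upwards [ae_exists_forall_goodEvent F post 𝒜 hgood] with O hO
    exact ⟨𝒜, h𝒜, hO⟩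
  -- Step 2 (countably many algorithms): swap the quantifiers.
  have hall : ∀ᵐ (O : Set (List Bool)) ∂acOracleMeasure, ∀ M ∈ sampBQPAlgorithms,
      ∃ 𝒜 : OracleAdversary (List Bool), 𝒜.IsPPT (encodingList Bool) ∧
        ∃ K₀ : ℕ, 0 < K₀ ∧ ∀ (x : List Bool) (k : ℕ), K₀ ≤ k → O ∈ goodEvent M.1 M.2 𝒜 x k :=
    (ae_ball_iff countable_sampBQPAlgorithms).2 hone
  -- Step 3 (a fixed good oracle): the rescaled simulation solves every `SampBQP^{TQBF,O}` problem.
  filter_upwards [hall] with O hO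
  rintro S ⟨F, post, hU, hpost, hacc⟩
  obtain ⟨𝒜, h𝒜, K₀, hK₀, hK⟩ := hO (F, post) ⟨hU, hpost⟩
  obtain ⟨𝒜', h𝒜', hrun⟩ := 𝒜.exists_ppt_outputPMF_precomp h𝒜 (shiftAccuracy_mem_FP K₀)
  refine ⟨𝒜', h𝒜', fun x k hk => ?_⟩
  rw [hrun, shiftAccuracy_boolPair]
  set k' : ℕ := 2 * k + K₀ with hk'
  have hk'pos : 0 < k' := by omega
  have hKk' : K₀ ≤ k' := by omega
  have hclose : (lawM F post O x k').tvDist (lawA 𝒜 O x k') ≤ 1 / (k' : ℝ) := hK x k' hKk'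
  have hsolve : (lawM F post O x k').tvDist (S x) ≤ 1 / (k' : ℝ) := hacc x k' hk'pos
  have htri : (lawA 𝒜 O x k').tvDist (S x) ≤
      (lawA 𝒜 O x k').tvDist (lawM F post O x k') + (lawM F post O x k').tvDist (S x) :=
    PMF.tvDist_triangle_holds _ _ _
  have hhalf : 1 / (k' : ℝ) + 1 / (k' : ℝ) ≤ 1 / (k : ℝ) := by
    have hk0 : (0 : ℝ) < k := by exact_mod_cast hk
    have hkk : (2 * k : ℝ) ≤ k' := by
      rw [hk']; push_cast; linarith
    rw [← add_div, div_le_div_iff₀ (by positivity) hk0]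
    linarith
  calc (lawA 𝒜 O x k').tvDist (S x)
      ≤ (lawA 𝒜 O x k').tvDist (lawM F post O x k') + (lawM F post O x k').tvDist (S x) := htri
    _ ≤ 1 / (k' : ℝ) + 1 / (k' : ℝ) := add_le_add (by rwa [PMF.tvDist_comm]) hsolve
    _ ≤ 1 / (k : ℝ) := hhalf

/-- Hence the first half of Thm. 5.1 (`SampBPP^{TQBF,O} = SampBQP^{TQBF,O}` a.s.) from Lemma 5.3
and the trivial inclusion `SampBPP^A ⊆ SampBQP^A`. [cite: AaronsonChen2017, Thm. 5.1 (p. 21)] -/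
theorem aaronsonChen2017_thm51_samp_of_lem53 (h53 : aaronsonChen2017_lem53)
    (h' : SampPRel_subset_SampBQPRel) : aaronsonChen2017_thm51_samp :=
  aaronsonChen2017_thm51_samp_of (aaronsonChen2017_thm51_sampBQP_subset_of_lem53 h53) h'

/-- Hence Cor. 5.2 from Lemma 5.3, the trivial inclusion and the second half of Thm. 5.1.
[cite: AaronsonChen2017, Cor. 5.2 (p. 21)] -/
theorem aaronsonChen2017_cor52_of_lem53 (h53 : aaronsonChen2017_lem53)
    (h₂ : SampPRel_subset_SampBQPRel) (h₃ : aaronsonChen2017_thm51_ph) : aaronsonChen2017_cor52 :=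
  aaronsonChen2017_cor52_of_parts (aaronsonChen2017_thm51_sampBQP_subset_of_lem53 h53) h₂ h₃

/-! ### Revision 2: the leaf list after the tree's decomposition of Lemma 5.3 -/

/-- **The target from the two leaves of Lemma 5.3**: the `SampBPP^{TQBF,O}` machine
(`aaronsonChen2017_lem53_machine`) and the probabilistic analysis of the replacement process
(`aaronsonChen2017_lem53_losses`) of `AaronsonChenSimulation.lean` give Lemma 5.3
(`aaronsonChen2017_lem53_of_parts` there), hence the almost-sure inclusion
`SampBQP^{TQBF,O} ⊆ SampBPP^{TQBF,O}`. [cite: AaronsonChen2017, Thm. 5.1 (first part) and Lemma 5.3 (pp. 21–23)] -/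
theorem aaronsonChen2017_thm51_sampBQP_subset_of_lem53_leaves (hM : aaronsonChen2017_lem53_machine)
    (hL : aaronsonChen2017_lem53_losses) : aaronsonChen2017_thm51_sampBQP_subset :=
  aaronsonChen2017_thm51_sampBQP_subset_of_lem53 (aaronsonChen2017_lem53_of_parts hM hL)

/-- **Cor. 5.2 from its current leaves**: the two leaves of Lemma 5.3, the trivial inclusion
`SampBPP^A ⊆ SampBQP^A` and the `PH` half of Thm. 5.1. [cite: AaronsonChen2017, Cor. 5.2 (p. 21)] -/
theorem aaronsonChen2017_cor52_of_lem53_leaves (hM : aaronsonChen2017_lem53_machine)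
    (hL : aaronsonChen2017_lem53_losses) (h₂ : SampPRel_subset_SampBQPRel)
    (h₃ : aaronsonChen2017_thm51_ph) : aaronsonChen2017_cor52 :=
  aaronsonChen2017_cor52_of_lem53 (aaronsonChen2017_lem53_of_parts hM hL) h₂ h₃

end Literature.Barriers.QuantumAdvantage

end
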